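import Summits.NavierStokesRegularity.NavierStokesRegularity.Theorems.ExtremiserTransienceLocalMaximiserLocalSlack
import HarnessLib

/-!
# Route `ExtremiserTransience`, crux `NearExtremalTransiencePerFlow` (stmt-NavierStokesRegularity-26567),
# LINE g10-1 «two_thirds» (ideator ns-idea-10 g10), stub S1a `TypicalSelection` — BRICK 1: the SET-VALUED thick-good selection

`--supports stmt-NavierStokesRegularity-26567` (helper; prover seat ns-net-p2 g12).  The landed L2 `thickGoodCentre_holds` (p710316,
ns-net-p1 g14) gives ONE thick good centre; S1a needs the centre to be ALSO enstrophy-typical at every scale, i.e. to lie in an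
enstrophy-large set `Y` produced by the partition argument.  Card `Lines/two_thirds.md` («g9's `Selection` must be re-run to give an
enstrophy-LARGE set of admissible centres rather than one — elementary but unwritten»).  This file supplies exactly that:

* `exists_thickGood_mem_of_slack` — in the `A`-regular admissible class, with `θ₀ = κ⋆/4` and `c₀ = κ⋆/(4A₁)`: for all `R, η > 0`
  some `ε₀ > 0` works: if `v` is `(κ⋆−ε)`-extremal (`0 ≤ ε ≤ ε₀`) with slack summability at level `ε` (the conclusion of L1), then EVERY
  measurable set `Y` carrying enstrophy `> (1 − c₀)·Z` contains a THICK GOOD centre `x₀ ∈ Y` (`‖curl v x₀‖ ≥ θ₀M/λ`, every admissible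
  test inside `B(x₀, Rλ)` gains `≤ ηM³`);
* `exists_thickGood_mem` — the same with the slack hypothesis discharged by the landed L1 `localSlack_holds` (p712515).

PROOF (the landed L2 argument, localised to `Y`).  If every thick point of `Y` carried a bad test: (1) thin/thick split
`thick_enstrophy_lower_bound`: `∫_Θ ‖ω‖² ≥ (κ⋆ − ε − θ₀)·Z/A₁`, so the THIN set carries `≤ (1 − (κ⋆−ε−θ₀)/A₁)·Z`; (2) `2Rλ`-separated finite
subsets of `Y ∩ Θ` have bad tests with disjoint supports, so slack summability bounds their cardinality by `ε√Z√W/(ηM²)`; (3) a maximal one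
covers `Y ∩ Θ` by `2Rλ`-balls (`exists_separated_finset_cover`), whence `∫_{Y∩Θ} ‖ω‖² ≤ (Kε/(A₁η))·Z` (`setIntegral_biUnion_ball_le`,
`K = 8‖curlCLM‖²A₁³R³·vol B₁`); (4) `∫_Y ≤ ∫_thin + ∫_{Y∩Θ} ≤ (1 − (κ⋆ − ε − θ₀ − Kε/η)/A₁)·Z ≤ (1 − c₀)·Z` once `ε ≤ κ⋆/4` and
`Kε/η ≤ κ⋆/4` — contradiction.
HONEST FRAMING: a lemma about ONE admissible vector field; nothing about Navier–Stokes regularity or blow-up is proved; no summit is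
proved by a line. [folklore]
-/

noncomputable section

open scoped Topology InnerProductSpace RealInnerProductSpace ENNReal ContDiff
open MeasureTheory Filter Set Metric
open Literature.Analysis.FluidPDE
open Summit.NavierStokesRegularity.NavierStokesRegularity.Theorems.DepletionLadder
open Summit.NavierStokesRegularity.NavierStokesRegularity.Theorems.DepletionLadder.KStar.HalfSpace
open Summit.NavierStokesRegularity.NavierStokesRegularity.Theorems.DepletionLadder.KStar.BangBang
open Summit.NavierStokesRegularity.NavierStokesRegularity.Theorems.NearExtremalTransiencePerFlow.LocalMaximiser

namespace Summit.NavierStokesRegularity.NavierStokesRegularity.Theorems.NearExtremalTransiencePerFlow.TwoThirds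

-- the problem directory repeats the summit name (`NavierStokesRegularity/NavierStokesRegularity`)
set_option linter.dupNamespace false
set_option linter.style.longLine false

/-- **Set-valued thick-good selection under slack summability.**  In the `A`-regular admissible class there are `θ₀ = κ⋆/4` and
`c₀ = κ⋆/(4A₁) > 0` such that for all `R, η > 0` some `ε₀ > 0` works: for a `(κ⋆−ε)`-extremal `v` (`0 ≤ ε ≤ ε₀`) whose disjoint admissible
test families have summable local gains `≤ εM√Z√W`, every measurable set `Y` with `∫_Y ‖curl v‖² > (1 − c₀)·Z` contains a centre `x₀`
with `‖curl v x₀‖ ≥ θ₀M/λ` all of whose admissible tests inside `B(x₀, Rλ)` gain at most `ηM³`. [folklore] -/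
theorem exists_thickGood_mem_of_slack :
    ∀ A : ℕ → ℝ, (∀ j, 1 ≤ A j) → ∃ θ₀ c₀ : ℝ, 0 < θ₀ ∧ 0 < c₀ ∧ ∀ (R η : ℝ), 0 < R → 0 < η → ∃ ε₀ : ℝ, 0 < ε₀ ∧
    ∀ (v : E3 → E3) (M B ε : ℝ), IsAdm v M B → IsReg A v M → 0 < Zen v → 0 < Wpa v → 0 ≤ ε → ε ≤ ε₀ →
      (kStar - ε) * M * Real.sqrt (Zen v) * Real.sqrt (Wpa v) ≤ Jst v →
      (∀ (k : ℕ) (φ : Fin k → E3 → E3), (∀ i, IsTestAt v M (φ i)) →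
        (∀ i j, i ≠ j → Disjoint (tsupport (φ i)) (tsupport (φ j))) →
        ∑ i, locGain (kStar * M) (lam v) v (φ i) ≤ ε * M * Real.sqrt (Zen v) * Real.sqrt (Wpa v)) →
      ∀ Y : Set E3, MeasurableSet Y → (1 - c₀) * Zen v < ∫ x in Y, ‖curl v x‖ ^ 2 →
      ∃ x₀ ∈ Y, θ₀ * M * (lam v)⁻¹ ≤ ‖curl v x₀‖ ∧
        ∀ φ : E3 → E3, IsTestAt v M φ → tsupport φ ⊆ Metric.ball x₀ (R * lam v) →
          locGain (kStar * M) (lam v) v φ ≤ η * M ^ 3 := by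
  intro A hA
  have hκ : 0 < kStar := kStar_pos
  have hA1 : 0 < A 1 := lt_of_lt_of_le one_pos (hA 1)
  refine ⟨kStar / 4, kStar / (4 * A 1), by positivity, by positivity, ?_⟩
  intro R η hR hη
  -- constants of the problem
  set b : ℝ := (volume (Metric.ball (0 : E3) 1)).toReal with hb
  have hb0 : 0 ≤ b := ENNReal.toReal_nonneg
  have hcω0 : 0 ≤ ‖curlCLM‖ := norm_nonneg curlCLM
  set cω : ℝ := ‖curlCLM‖ with hcω
  set K : ℝ := 8 * cω ^ 2 * A 1 ^ 3 * R ^ 3 * b with hK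
  have hK0 : 0 ≤ K := by positivity
  refine ⟨min (kStar / 4) (kStar * η / (4 * (K + 1))), lt_min (by positivity) (by positivity), ?_⟩
  intro v M B ε hadm hreg hZ hW hε0 hε hext hslack Y hY hYlarge
  have hε1 : ε ≤ kStar / 4 := hε.trans (min_le_left _ _)
  have hε2 : ε ≤ kStar * η / (4 * (K + 1)) := hε.trans (min_le_right _ _)
  obtain ⟨hv, hdiv, hvM, hvB, h0, h1, h2⟩ := id hadm
  have hv1 : ContDiff ℝ 1 v := hv.of_le (by norm_cast)
  have hv2 : ContDiff ℝ 2 v := hv.of_le (by norm_cast)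
  -- positivity of `λ`, `M`, `√Z√W`
  have hl : 0 < lam v := Real.sqrt_pos.2 (div_pos hZ hW)
  have hM : 0 < M := by
    by_contra hM'
    have hM0 : M ≤ 0 := not_lt.1 hM'
    have hv0 : v = 0 := by
      funext x
      exact norm_le_zero_iff.1 ((hvM x).trans hM0)
    have hZ0 : Zen v = 0 := by
      unfold Zen; simp [hv0]
    exact hZ.ne' hZ0
  have hS : 0 < Real.sqrt (Zen v) * Real.sqrt (Wpa v) := mul_pos (Real.sqrt_pos.2 hZ) (Real.sqrt_pos.2 hW)
  -- `Z / λ = √Z √W`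
  have hlamZ : (lam v)⁻¹ * Zen v = Real.sqrt (Zen v) * Real.sqrt (Wpa v) := by
    have hlam : lam v = Real.sqrt (Zen v) / Real.sqrt (Wpa v) := by
      unfold lam; exact Real.sqrt_div' (Zen v) hW.le
    rw [hlam, inv_div, div_mul_eq_mul_div, mul_div_assoc, Real.div_sqrt, mul_comm]
  -- `‖Dv‖ ≤ A₁M/λ` and `‖ω‖² ≤ (‖curlCLM‖ A₁ M/λ)²`
  have hDv : ∀ x, ‖fderiv ℝ v x‖ ≤ A 1 * M * (lam v)⁻¹ := fun x => by
    have h := hreg 1 x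
    rwa [norm_iteratedFDeriv_one, pow_one] at h
  have hωbd : ∀ x, ‖curl v x‖ ^ 2 ≤ (cω * (A 1 * M * (lam v)⁻¹)) ^ 2 := fun x => by
    have h₁ : ‖curl v x‖ ≤ cω * ‖fderiv ℝ v x‖ := Literature.Analysis.FluidPDE.norm_curl_le v x
    have h₂ : cω * ‖fderiv ℝ v x‖ ≤ cω * (A 1 * M * (lam v)⁻¹) := mul_le_mul_of_nonneg_left (hDv x) hcω0
    exact pow_le_pow_left₀ (norm_nonneg _) (h₁.trans h₂) 2
  -- the thick set and the contradiction hypothesis (every thick point OF `Y` carries a bad test)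
  set Θ : Set E3 := {x | kStar / 4 * M * (lam v)⁻¹ ≤ ‖curl v x‖} with hΘ
  have hΘm : MeasurableSet Θ :=
    (isClosed_le continuous_const (continuous_curl hv1).norm).measurableSet
  by_contra hneg
  push Not at hneg
  have hchoice : ∀ x : E3, ∃ φ : E3 → E3, x ∈ Y ∩ Θ →
      (IsTestAt v M φ ∧ tsupport φ ⊆ Metric.ball x (R * lam v) ∧
        η * M ^ 3 < locGain (kStar * M) (lam v) v φ) := by
    intro x
    by_cases hx : x ∈ Y ∩ Θ
    · obtain ⟨φ, hφ⟩ := hneg x hx.1 hx.2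
      exact ⟨φ, fun _ => hφ⟩
    · exact ⟨0, fun h => absurd h hx⟩
  choose f hf using hchoice
  -- step 2: separated subsets of `Y ∩ Θ` are small
  have hcard : ∀ P : Finset E3, (↑P : Set E3) ⊆ Y ∩ Θ →
      (∀ p ∈ P, ∀ q ∈ P, p ≠ q → 2 * (R * lam v) ≤ dist p q) →
      (P.card : ℝ) * (η * M ^ 3) ≤ ε * M * Real.sqrt (Zen v) * Real.sqrt (Wpa v) := by
    intro P hPΘ hPsep
    classical
    set e := P.equivFin with he
    set φ : Fin P.card → E3 → E3 := fun i => f ((e.symm i : P) : E3) with hφ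
    have hmem : ∀ i : Fin P.card, ((e.symm i : P) : E3) ∈ Y ∩ Θ := fun i => hPΘ (e.symm i).2
    have htest : ∀ i, IsTestAt v M (φ i) := fun i => (hf _ (hmem i)).1
    have hdisj : ∀ i j, i ≠ j → Disjoint (tsupport (φ i)) (tsupport (φ j)) := by
      intro i j hij
      have hne : ((e.symm i : P) : E3) ≠ ((e.symm j : P) : E3) := fun h =>
        hij (e.symm.injective (Subtype.ext h))
      have hd := hPsep _ (e.symm i).2 _ (e.symm j).2 hne
      exact Set.disjoint_of_subset (hf _ (hmem i)).2.1 (hf _ (hmem j)).2.1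
        (Metric.ball_disjoint_ball (by linarith))
    have hs := hslack P.card φ htest hdisj
    have hlow : ∑ _i : Fin P.card, η * M ^ 3 ≤ ∑ i, locGain (kStar * M) (lam v) v (φ i) :=
      Finset.sum_le_sum fun i _ => (hf _ (hmem i)).2.2.le
    rw [Finset.sum_const, Finset.card_univ, Fintype.card_fin, nsmul_eq_mul] at hlow
    linarith
  have hN : ∀ P : Finset E3, (↑P : Set E3) ⊆ Y ∩ Θ →
      (∀ p ∈ P, ∀ q ∈ P, p ≠ q → 2 * (R * lam v) ≤ dist p q) →
      P.card ≤ ⌊ε * M * Real.sqrt (Zen v) * Real.sqrt (Wpa v) / (η * M ^ 3)⌋₊ := by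
    intro P hPΘ hPsep
    refine Nat.le_floor ?_
    rw [le_div_iff₀ (by positivity)]
    exact hcard P hPΘ hPsep
  -- step 3: a maximal separated finite set covers `Y ∩ Θ`
  obtain ⟨P, hPΘ, hPsep, hcov⟩ :=
    exists_separated_finset_cover (S := Y ∩ Θ) (by positivity : (0 : ℝ) < 2 * (R * lam v)) hN
  have hω2 : Integrable (fun x => ‖curl v x‖ ^ 2) := (integrable_norm_curl_sq hv2 h1).1
  have hYΘ : ∫ x in Y ∩ Θ, ‖curl v x‖ ^ 2 ≤ ∫ x in ⋃ p ∈ P, Metric.ball p (2 * (R * lam v)), ‖curl v x‖ ^ 2 :=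
    setIntegral_mono_set hω2.integrableOn (Eventually.of_forall fun x => sq_nonneg _) hcov.eventuallyLE
  have hU := setIntegral_biUnion_ball_le (v := v) P (by positivity : (0 : ℝ) < 2 * (R * lam v)) hωbd
  -- step 1: the thin/thick split bounds the THIN enstrophy
  have hC := thick_enstrophy_lower_bound (θ₀ := kStar / 4) hadm hreg hZ hW (by positivity) hext
  -- decomposition `∫_Y = ∫_{Y ∩ Θ} + ∫_{Y \ Θ}`, `∫_{Y \ Θ} ≤ ∫_{Θᶜ} = Z − ∫_Θ`
  have hsplit : ∫ x in Y, ‖curl v x‖ ^ 2 = (∫ x in Y ∩ Θ, ‖curl v x‖ ^ 2) + ∫ x in Y \ Θ, ‖curl v x‖ ^ 2 :=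
    (integral_inter_add_sdiff hΘm hω2.integrableOn).symm
  have hthin : ∫ x in Y \ Θ, ‖curl v x‖ ^ 2 ≤ ∫ x in Θᶜ, ‖curl v x‖ ^ 2 :=
    setIntegral_mono_set hω2.integrableOn (Eventually.of_forall fun x => sq_nonneg _)
      (Eventually.of_forall fun x hx => hx.2)
  have hcompl : (∫ x in Θ, ‖curl v x‖ ^ 2) + ∫ x in Θᶜ, ‖curl v x‖ ^ 2 = Zen v := by
    unfold Zen; exact integral_add_compl hΘm hω2
  -- step 4: cancel the powers of `λ` and `M`
  have hprod : (cω * (A 1 * M * (lam v)⁻¹)) ^ 2 * ((P.card : ℝ) * ((2 * (R * lam v)) ^ 3 * b)) =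
      K / A 1 * M ^ 2 * lam v * P.card := by
    rw [hK]
    field_simp
    ring
  have hcP := hcard P hPΘ hPsep
  -- `∫_{Y∩Θ} ≤ (K/A₁) M² λ #P ≤ (K ε/(A₁ η)) · λ √Z √W = (K ε /(A₁ η)) · Z`
  have hbad : ∫ x in Y ∩ Θ, ‖curl v x‖ ^ 2 ≤ K * ε / (A 1 * η) * Zen v := by
    have h1' : ∫ x in Y ∩ Θ, ‖curl v x‖ ^ 2 ≤ K / A 1 * M ^ 2 * lam v * P.card := by
      rw [← hprod]; exact hYΘ.trans hU
    have h2' : K / A 1 * M ^ 2 * lam v * P.card ≤ K / A 1 * M ^ 2 * lam v * (ε * M * Real.sqrt (Zen v) * Real.sqrt (Wpa v) / (η * M ^ 3)) := by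
      have : (P.card : ℝ) ≤ ε * M * Real.sqrt (Zen v) * Real.sqrt (Wpa v) / (η * M ^ 3) := by
        rw [le_div_iff₀ (by positivity)]; exact hcP
      exact mul_le_mul_of_nonneg_left this (by positivity)
    have h3' : K / A 1 * M ^ 2 * lam v * (ε * M * Real.sqrt (Zen v) * Real.sqrt (Wpa v) / (η * M ^ 3)) =
        K * ε / (A 1 * η) * (lam v * (Real.sqrt (Zen v) * Real.sqrt (Wpa v))) := by
      field_simp
    have h4' : lam v * (Real.sqrt (Zen v) * Real.sqrt (Wpa v)) = Zen v := by
      rw [← hlamZ, ← mul_assoc, mul_inv_cancel₀ hl.ne', one_mul]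
    calc ∫ x in Y ∩ Θ, ‖curl v x‖ ^ 2 ≤ K / A 1 * M ^ 2 * lam v * P.card := h1'
      _ ≤ K / A 1 * M ^ 2 * lam v * (ε * M * Real.sqrt (Zen v) * Real.sqrt (Wpa v) / (η * M ^ 3)) := h2'
      _ = K * ε / (A 1 * η) * Zen v := by rw [h3', h4']
  -- `∫_Θ ≥ (κ⋆ − ε − κ⋆/4) Z / A₁`
  have hthick : (kStar - ε - kStar / 4) / A 1 * Zen v ≤ ∫ x in Θ, ‖curl v x‖ ^ 2 := by
    have e1 : (kStar - ε - kStar / 4) * M * Real.sqrt (Zen v) * Real.sqrt (Wpa v) =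
        (A 1 * M * (lam v)⁻¹) * ((kStar - ε - kStar / 4) / A 1 * Zen v) := by
      have e0 : (kStar - ε - kStar / 4) * M * Real.sqrt (Zen v) * Real.sqrt (Wpa v) =
          (kStar - ε - kStar / 4) * M * ((lam v)⁻¹ * Zen v) := by rw [hlamZ]; ring
      rw [e0]; field_simp
    rw [e1] at hC
    exact le_of_mul_le_mul_left hC (by positivity)
  -- assemble: `∫_Y ≤ Z − (κ⋆ − ε − κ⋆/4) Z/A₁ + K ε Z/(A₁ η)`
  have hKε : K * ε / η ≤ kStar / 4 := by
    have h6 : K * ε / η ≤ K * (kStar * η / (4 * (K + 1))) / η := by gcongr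
    have e5 : K * (kStar * η / (4 * (K + 1))) / η = kStar / 4 * (K / (K + 1)) := by
      field_simp
    have h7 : K / (K + 1) ≤ 1 := by
      rw [div_le_one (by linarith)]
      linarith
    calc K * ε / η ≤ K * (kStar * η / (4 * (K + 1))) / η := h6
      _ = kStar / 4 * (K / (K + 1)) := e5
      _ ≤ kStar / 4 * 1 := mul_le_mul_of_nonneg_left h7 (by positivity)
      _ = kStar / 4 := mul_one _
  have hfinal : ∫ x in Y, ‖curl v x‖ ^ 2 ≤ (1 - kStar / (4 * A 1)) * Zen v := by
    have hq : K * ε / (A 1 * η) * Zen v ≤ kStar / 4 / A 1 * Zen v := by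
      have : K * ε / (A 1 * η) = (K * ε / η) / A 1 := by field_simp
      rw [this]
      exact mul_le_mul_of_nonneg_right (div_le_div_of_nonneg_right hKε hA1.le) hZ.le
    have hr : (kStar - kStar / 4 - kStar / 4) / A 1 * Zen v ≤ (kStar - ε - kStar / 4) / A 1 * Zen v := by
      apply mul_le_mul_of_nonneg_right _ hZ.le
      exact div_le_div_of_nonneg_right (by linarith) hA1.le
    have e : (1 - kStar / (4 * A 1)) * Zen v =
        Zen v - (kStar - kStar / 4 - kStar / 4) / A 1 * Zen v + kStar / 4 / A 1 * Zen v := by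
      field_simp; ring
    rw [hsplit, e]
    linarith [hbad, hthin, hcompl, hthick, hq, hr]
  linarith [hfinal, hYlarge]

/-- **Set-valued thick-good selection** (slack summability discharged by the landed L1 `localSlack_holds`): in the `A`-regular admissible
class, every measurable set carrying enstrophy `> (1 − c₀)·Z` of a `(κ⋆−ε)`-extremal slice (`ε ≤ ε₀(A,R,η)`) contains a thick good centre.
This is the form S1a `TypicalSelection` consumes: intersect with the enstrophy-large set of all-scale-typical points. [folklore] -/
theorem exists_thickGood_mem :
    ∀ A : ℕ → ℝ, (∀ j, 1 ≤ A j) → ∃ θ₀ c₀ : ℝ, 0 < θ₀ ∧ 0 < c₀ ∧ ∀ (R η : ℝ), 0 < R → 0 < η → ∃ ε₀ : ℝ, 0 < ε₀ ∧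
    ∀ (v : E3 → E3) (M B ε : ℝ), IsAdm v M B → IsReg A v M → 0 < Zen v → 0 < Wpa v → 0 ≤ ε → ε ≤ ε₀ →
      (kStar - ε) * M * Real.sqrt (Zen v) * Real.sqrt (Wpa v) ≤ Jst v →
      ∀ Y : Set E3, MeasurableSet Y → (1 - c₀) * Zen v < ∫ x in Y, ‖curl v x‖ ^ 2 →
      ∃ x₀ ∈ Y, θ₀ * M * (lam v)⁻¹ ≤ ‖curl v x₀‖ ∧
        ∀ φ : E3 → E3, IsTestAt v M φ → tsupport φ ⊆ Metric.ball x₀ (R * lam v) →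
          locGain (kStar * M) (lam v) v φ ≤ η * M ^ 3 := by
  intro A hA
  obtain ⟨θ₀, c₀, hθ₀, hc₀, h⟩ := exists_thickGood_mem_of_slack A hA
  refine ⟨θ₀, c₀, hθ₀, hc₀, fun R η hR hη => ?_⟩
  obtain ⟨ε₀, hε₀, h'⟩ := h R η hR hη
  refine ⟨ε₀, hε₀, fun v M B ε hadm hreg hZ hW hε0 hε hext => ?_⟩
  exact h' v M B ε hadm hreg hZ hW hε0 hε hext fun k φ hφ hdisj =>
    localSlack_holds v M B ε k φ hadm hZ hW hext hφ hdisj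

end Summit.NavierStokesRegularity.NavierStokesRegularity.Theorems.NearExtremalTransiencePerFlow.TwoThirds

end
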